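import Mathlib
import HarnessLib
import Summits.KontsevichZagierPeriods.Zeta5Search.Denom.TwoTaleP15Decay

/-!
# TwoTaleP15LineTail — E5-3: the tail `|y| ≥ y₀` of the P15 vertical-line modulus, derivative-free

HONEST FRAMING: systematic search; no irrationality claim unless certified.

fam-measure g3 for fam-denom's E5 design (`families/denom/P15KERNEL.md` §8.3), pub-zeta5.  For the rational
function `ratRC n` of `Denom/TwoTaleP15Decay` (Zudilin's `R(t)` at P15) on a vertical line `t = u + iy`,
`u` real:
* `norm_ratRC_eq` — the EXACT factorisation of the modulus: `‖ratRC n (u+iy)‖ = P₁₃ₙ/(13n)! · P₉ₙ/(9n)! ·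
  P₅ₙ/(5n)! · (11n)!/P_den` with `P_s = ∏_{i∈s} √((u+i)² + y²)` (`blockNorm`);
* evenness in `y` (`norm_ratRC_neg`), and for `0 < y₀ ≤ y`: every numerator factor grows at most like `y/y₀`
  and no denominator factor decreases, hence **`norm_ratRC_le_pow_mul`**:
  `‖ratRC n (u+iy)‖ ≤ (y/y₀)^{27n} · ‖ratRC n (u+iy₀)‖`;
* `one_div_cosh_sq_le : 1/cosh²(πy) ≤ 4 e^{−2π|y|}` and the elementary `pow_mul_exp_le`:
  `(y/y₀)^{27n} e^{−2πy} ≤ e^{−2πy₀} e^{−3(y−y₀)}` whenever `27n ≤ 3y₀` (`log (y/y₀) ≤ (y−y₀)/y₀`, `π > 3`);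
* **`norm_ratRC_div_cosh_sq_le_tail`**: for `|y| ≥ y₀ > 0` and `27n ≤ 3y₀`,
  `‖ratRC n (u+iy)‖ / cosh²(πy) ≤ 4 · (‖ratRC n (u+iy₀)‖ · e^{−2πy₀}) · e^{−3(|y|−y₀)}`,
  and its instance on the tree's line argument `((xₙ+½ : ℝ) : ℂ) − (11n+1) + y·I` with `y₀ = 9n`
  (`norm_ratRC_line_div_cosh_sq_le_tail`), which is the `|y| ≥ 9n` half of the majorant of §8.5 (E5-5).
No derivative, no Riemann sum; nothing here is specific to `ξ = 26/5`.  Nothing about `ζ(2)` is claimed.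
-/

noncomputable section

open Finset Complex

namespace Summit.KontsevichZagierPeriods.Zeta5Search.Denom.TwoTaleP15LineTail

open Summit.KontsevichZagierPeriods.Zeta5Search.Denom.TwoTaleP15Decay (ratRC)

/-! ### Block moduli -/

/-- `blockNorm s u y = ∏_{i ∈ s} √((u+i)² + y²)`, the modulus of `∏_{i∈s} (u + iy + i)`. -/
def blockNorm (s : Finset ℕ) (u y : ℝ) : ℝ := ∏ i ∈ s, Real.sqrt ((u + i) ^ 2 + y ^ 2)

/-- The modulus of one linear factor: `‖u + iy + i‖ = √((u+i)² + y²)`. -/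
theorem norm_linFactor (u y : ℝ) (i : ℕ) :
    ‖(u : ℂ) + (y : ℂ) * I + (i : ℂ)‖ = Real.sqrt ((u + i) ^ 2 + y ^ 2) := by
  have h : (u : ℂ) + (y : ℂ) * I + (i : ℂ) = ((u + i : ℝ) : ℂ) + ((y : ℝ) : ℂ) * I := by push_cast; ring
  rw [h, Complex.norm_add_mul_I]

/-- The modulus of a block: `‖∏_{i∈s} (u + iy + i)‖ = blockNorm s u y`. -/
theorem norm_prod_linFactor (s : Finset ℕ) (u y : ℝ) :
    ‖∏ i ∈ s, ((u : ℂ) + (y : ℂ) * I + (i : ℂ))‖ = blockNorm s u y := by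
  rw [norm_prod, blockNorm]
  exact Finset.prod_congr rfl fun i _ => norm_linFactor u y i

/-- `blockNorm` is even in `y`. -/
theorem blockNorm_neg (s : Finset ℕ) (u y : ℝ) : blockNorm s u (-y) = blockNorm s u y := by
  simp [blockNorm]

/-- `blockNorm s u y ≥ 0`. -/
theorem blockNorm_nonneg (s : Finset ℕ) (u y : ℝ) : 0 ≤ blockNorm s u y :=
  Finset.prod_nonneg fun _ _ => Real.sqrt_nonneg _

/-- `blockNorm s u y > 0` off the real axis (`y ≠ 0`). -/
theorem blockNorm_pos (s : Finset ℕ) (u : ℝ) {y : ℝ} (hy : y ≠ 0) : 0 < blockNorm s u y :=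
  Finset.prod_pos fun _ _ => Real.sqrt_pos.2 (by positivity)

/-- Monotonicity in the height: `blockNorm s u y₀ ≤ blockNorm s u y` for `0 ≤ y₀ ≤ y`. -/
theorem blockNorm_mono (s : Finset ℕ) (u : ℝ) {y₀ y : ℝ} (h0 : 0 ≤ y₀) (hy : y₀ ≤ y) :
    blockNorm s u y₀ ≤ blockNorm s u y := by
  refine Finset.prod_le_prod (fun _ _ => Real.sqrt_nonneg _) fun i _ => ?_
  exact Real.sqrt_le_sqrt (by nlinarith)

/-- One factor grows at most like `y/y₀`: `√((u+i)²+y²) ≤ (y/y₀) · √((u+i)²+y₀²)` for `0 < y₀ ≤ y`. -/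
theorem sqrt_le_div_mul_sqrt (v : ℝ) {y₀ y : ℝ} (h0 : 0 < y₀) (hy : y₀ ≤ y) :
    Real.sqrt (v ^ 2 + y ^ 2) ≤ y / y₀ * Real.sqrt (v ^ 2 + y₀ ^ 2) := by
  have hq : 0 ≤ y / y₀ := div_nonneg (h0.le.trans hy) h0.le
  have hkey : v ^ 2 + y ^ 2 ≤ (y / y₀) ^ 2 * (v ^ 2 + y₀ ^ 2) := by
    rw [div_pow, div_mul_eq_mul_div, le_div_iff₀ (by positivity)]
    have h1 : y₀ ^ 2 ≤ y ^ 2 := by gcongr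
    nlinarith [mul_le_mul_of_nonneg_left h1 (sq_nonneg v)]
  calc Real.sqrt (v ^ 2 + y ^ 2) ≤ Real.sqrt ((y / y₀) ^ 2 * (v ^ 2 + y₀ ^ 2)) := Real.sqrt_le_sqrt hkey
    _ = y / y₀ * Real.sqrt (v ^ 2 + y₀ ^ 2) := by
        rw [Real.sqrt_mul (sq_nonneg _), Real.sqrt_sq hq]

/-- A block grows at most like `(y/y₀)^{#s}`: `blockNorm s u y ≤ (y/y₀)^{#s} · blockNorm s u y₀` for `0 < y₀ ≤ y`. -/
theorem blockNorm_le_pow_mul (s : Finset ℕ) (u : ℝ) {y₀ y : ℝ} (h0 : 0 < y₀) (hy : y₀ ≤ y) :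
    blockNorm s u y ≤ (y / y₀) ^ s.card * blockNorm s u y₀ := by
  unfold blockNorm
  rw [← Finset.prod_const, ← Finset.prod_mul_distrib]
  exact Finset.prod_le_prod (fun _ _ => Real.sqrt_nonneg _) fun i _ => sqrt_le_div_mul_sqrt (u + i) h0 hy

/-! ### The modulus of `ratRC` on a vertical line -/

/-- **Exact factorisation of the modulus**: `‖ratRC n (u+iy)‖ = P₁/(13n)! · (P₂/(9n)!) · (P₃/(5n)!) · ((11n)!/P₄)`
with `P₁ = blockNorm (Ico 1 (13n+1))`, `P₂ = blockNorm (Ico (2n+1) (11n+1))`, `P₃ = blockNorm (Ico (4n+1) (9n+1))`,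
`P₄ = blockNorm (Ico (15n+1) (26n+2))`, all at `(u, y)`. -/
theorem norm_ratRC_eq (n : ℕ) (u y : ℝ) :
    ‖ratRC n ((u : ℂ) + (y : ℂ) * I)‖ =
      blockNorm (Ico 1 (13 * n + 1)) u y / Nat.factorial (13 * n) *
        (blockNorm (Ico (2 * n + 1) (11 * n + 1)) u y / Nat.factorial (9 * n)) *
        (blockNorm (Ico (4 * n + 1) (9 * n + 1)) u y / Nat.factorial (5 * n)) *
        (Nat.factorial (11 * n) / blockNorm (Ico (15 * n + 1) (26 * n + 2)) u y) := by
  simp only [ratRC, norm_mul, norm_div, Complex.norm_natCast, norm_prod_linFactor]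

/-- `‖ratRC n (u+iy)‖` is even in `y`. -/
theorem norm_ratRC_neg (n : ℕ) (u y : ℝ) :
    ‖ratRC n ((u : ℂ) + ((-y : ℝ) : ℂ) * I)‖ = ‖ratRC n ((u : ℂ) + (y : ℂ) * I)‖ := by
  rw [norm_ratRC_eq, norm_ratRC_eq]
  simp only [blockNorm_neg]

/-- `‖ratRC n (u + i|y|)‖ = ‖ratRC n (u + iy)‖`. -/
theorem norm_ratRC_abs (n : ℕ) (u y : ℝ) :
    ‖ratRC n ((u : ℂ) + ((|y| : ℝ) : ℂ) * I)‖ = ‖ratRC n ((u : ℂ) + (y : ℂ) * I)‖ := by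
  rcases le_or_gt 0 y with h | h
  · rw [abs_of_nonneg h]
  · rw [abs_of_neg h, norm_ratRC_neg]

/-- The three numerator blocks have `13n + 9n + 5n = 27n` factors. -/
theorem card_blocks (n : ℕ) :
    (Ico 1 (13 * n + 1)).card + (Ico (2 * n + 1) (11 * n + 1)).card + (Ico (4 * n + 1) (9 * n + 1)).card =
      27 * n := by
  simp only [Nat.card_Ico]
  omega

/-- **Growth in the height is at most `(y/y₀)^{27n}`**: for `0 < y₀ ≤ y`,
`‖ratRC n (u+iy)‖ ≤ (y/y₀)^{27n} · ‖ratRC n (u+iy₀)‖` (27n numerator factors each `≤ (y/y₀)·(its value at y₀)`,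
the `11n+1` denominator factors do not decrease). -/
theorem norm_ratRC_le_pow_mul (n : ℕ) (u : ℝ) {y₀ y : ℝ} (h0 : 0 < y₀) (hy : y₀ ≤ y) :
    ‖ratRC n ((u : ℂ) + (y : ℂ) * I)‖ ≤ (y / y₀) ^ (27 * n) * ‖ratRC n ((u : ℂ) + (y₀ : ℂ) * I)‖ := by
  rw [norm_ratRC_eq, norm_ratRC_eq]
  set q : ℝ := y / y₀ with hq_def
  have hq : 0 ≤ q := div_nonneg (h0.le.trans hy) h0.le
  set s₁ := Ico 1 (13 * n + 1)
  set s₂ := Ico (2 * n + 1) (11 * n + 1)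
  set s₃ := Ico (4 * n + 1) (9 * n + 1)
  set s₄ := Ico (15 * n + 1) (26 * n + 2)
  have h₁ := blockNorm_le_pow_mul s₁ u h0 hy
  have h₂ := blockNorm_le_pow_mul s₂ u h0 hy
  have h₃ := blockNorm_le_pow_mul s₃ u h0 hy
  have h₄ : (Nat.factorial (11 * n) : ℝ) / blockNorm s₄ u y ≤ Nat.factorial (11 * n) / blockNorm s₄ u y₀ :=
    div_le_div_of_nonneg_left (by positivity) (blockNorm_pos s₄ u h0.ne') (blockNorm_mono s₄ u h0.le hy)
  have hcard : q ^ s₁.card * q ^ s₂.card * q ^ s₃.card = q ^ (27 * n) := by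
    rw [← pow_add, ← pow_add, card_blocks]
  have e₁ : 0 ≤ blockNorm s₁ u y₀ := blockNorm_nonneg _ _ _
  have e₂ : 0 ≤ blockNorm s₂ u y₀ := blockNorm_nonneg _ _ _
  have e₃ : 0 ≤ blockNorm s₃ u y₀ := blockNorm_nonneg _ _ _
  have e₄ : 0 ≤ (Nat.factorial (11 * n) : ℝ) / blockNorm s₄ u y₀ := by
    have := blockNorm_nonneg s₄ u y₀; positivity
  have f₁ : (0 : ℝ) < Nat.factorial (13 * n) := by positivity
  have f₂ : (0 : ℝ) < Nat.factorial (9 * n) := by positivity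
  have f₃ : (0 : ℝ) < Nat.factorial (5 * n) := by positivity
  calc blockNorm s₁ u y / Nat.factorial (13 * n) * (blockNorm s₂ u y / Nat.factorial (9 * n)) *
          (blockNorm s₃ u y / Nat.factorial (5 * n)) * (Nat.factorial (11 * n) / blockNorm s₄ u y)
        ≤ q ^ s₁.card * blockNorm s₁ u y₀ / Nat.factorial (13 * n) *
          (q ^ s₂.card * blockNorm s₂ u y₀ / Nat.factorial (9 * n)) *
          (q ^ s₃.card * blockNorm s₃ u y₀ / Nat.factorial (5 * n)) *
          (Nat.factorial (11 * n) / blockNorm s₄ u y₀) := by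
        have g₁ : 0 ≤ blockNorm s₁ u y / Nat.factorial (13 * n) := by
          have := blockNorm_nonneg s₁ u y; positivity
        have g₂ : 0 ≤ blockNorm s₂ u y / Nat.factorial (9 * n) := by
          have := blockNorm_nonneg s₂ u y; positivity
        have g₃ : 0 ≤ blockNorm s₃ u y / Nat.factorial (5 * n) := by
          have := blockNorm_nonneg s₃ u y; positivity
        have g₄ : 0 ≤ (Nat.factorial (11 * n) : ℝ) / blockNorm s₄ u y := by
          have := blockNorm_nonneg s₄ u y; positivity
        gcongr
    _ = q ^ (27 * n) * (blockNorm s₁ u y₀ / Nat.factorial (13 * n) * (blockNorm s₂ u y₀ / Nat.factorial (9 * n)) *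
          (blockNorm s₃ u y₀ / Nat.factorial (5 * n)) * (Nat.factorial (11 * n) / blockNorm s₄ u y₀)) := by
        rw [← hcard]; ring

/-! ### The kernel and the exponential bookkeeping -/

-- lane edit (lead/lit g13, dedup.landed): the folklore lemma `exp |x| ≤ 2 cosh x` restated a landed Literature lemma
-- (`Literature.Barriers.CriticalPhenomena.LongRangeIsing.exp_abs_le_two_mul_cosh`); it is inlined at its single use site below.

/-- **`1 / cosh²(πy) ≤ 4 e^{−2π|y|}`.** -/
theorem one_div_cosh_sq_le (y : ℝ) :
    1 / Real.cosh (Real.pi * y) ^ 2 ≤ 4 * Real.exp (-(2 * Real.pi * |y|)) := by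
  have hc : 0 < Real.cosh (Real.pi * y) := Real.cosh_pos _
  have h1 : Real.exp |Real.pi * y| ≤ 2 * Real.cosh (Real.pi * y) := by
    rw [← Real.cosh_abs, Real.cosh_eq]
    have := Real.exp_pos (-|Real.pi * y|)
    linarith
  have habs : |Real.pi * y| = Real.pi * |y| := by
    rw [abs_mul, abs_of_pos Real.pi_pos]
  rw [habs] at h1
  have h2 : Real.exp (Real.pi * |y|) ^ 2 ≤ (2 * Real.cosh (Real.pi * y)) ^ 2 := by
    gcongr
  have h3 : Real.exp (Real.pi * |y|) ^ 2 * Real.exp (-(2 * Real.pi * |y|)) = 1 := by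
    rw [← Real.exp_nat_mul, ← Real.exp_add]; norm_num; ring_nf
  rw [div_le_iff₀ (by positivity)]
  nlinarith [Real.exp_pos (-(2 * Real.pi * |y|)), h2]

/-- `(y/y₀)^{27n} ≤ e^{3(y − y₀)}` for `0 < y₀ ≤ y` and `27n ≤ 3y₀` (from `log (y/y₀) ≤ y/y₀ − 1`). -/
theorem pow_le_exp (n : ℕ) {y₀ y : ℝ} (h0 : 0 < y₀) (hy : y₀ ≤ y) (hn : (27 * n : ℝ) ≤ 3 * y₀) :
    (y / y₀) ^ (27 * n) ≤ Real.exp (3 * (y - y₀)) := by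
  have hq : 0 < y / y₀ := div_pos (h0.trans_le hy) h0
  rw [← Real.exp_log (pow_pos hq _), Real.exp_le_exp, Real.log_pow]
  have hlog : Real.log (y / y₀) ≤ y / y₀ - 1 := by
    have := Real.add_one_le_exp (Real.log (y / y₀))
    rw [Real.exp_log hq] at this; linarith
  have hq1 : 0 ≤ y / y₀ - 1 := by rw [sub_nonneg, le_div_iff₀ h0, one_mul]; exact hy
  have hdiff : y / y₀ - 1 = (y - y₀) / y₀ := by field_simp
  calc ((27 * n : ℕ) : ℝ) * Real.log (y / y₀) ≤ (27 * n : ℝ) * (y / y₀ - 1) := by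
        push_cast; exact mul_le_mul_of_nonneg_left hlog (by positivity)
    _ ≤ 3 * y₀ * (y / y₀ - 1) := mul_le_mul_of_nonneg_right hn hq1
    _ = 3 * (y - y₀) := by rw [hdiff]; field_simp

/-- **Exponential bookkeeping**: `(y/y₀)^{27n} · e^{−2πy} ≤ e^{−2πy₀} · e^{−3(y−y₀)}` for `0 < y₀ ≤ y`, `27n ≤ 3y₀`
(uses `π > 3`, i.e. `3 − 2π ≤ −3`). -/
theorem pow_mul_exp_le (n : ℕ) {y₀ y : ℝ} (h0 : 0 < y₀) (hy : y₀ ≤ y) (hn : (27 * n : ℝ) ≤ 3 * y₀) :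
    (y / y₀) ^ (27 * n) * Real.exp (-(2 * Real.pi * y)) ≤
      Real.exp (-(2 * Real.pi * y₀)) * Real.exp (-(3 * (y - y₀))) := by
  have h1 := pow_le_exp n h0 hy hn
  calc (y / y₀) ^ (27 * n) * Real.exp (-(2 * Real.pi * y))
        ≤ Real.exp (3 * (y - y₀)) * Real.exp (-(2 * Real.pi * y)) :=
          mul_le_mul_of_nonneg_right h1 (Real.exp_pos _).le
    _ ≤ Real.exp (-(2 * Real.pi * y₀)) * Real.exp (-(3 * (y - y₀))) := by
          rw [← Real.exp_add, ← Real.exp_add, Real.exp_le_exp]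
          nlinarith [Real.pi_gt_three, sub_nonneg.2 hy]

/-! ### The tail bound -/

/-- **E5-3, generic form.**  For `u` real, `0 < y₀ ≤ |y|` and `27n ≤ 3y₀`:
`‖ratRC n (u+iy)‖ / cosh²(πy) ≤ 4 · (‖ratRC n (u+iy₀)‖ · e^{−2πy₀}) · e^{−3(|y|−y₀)}`. -/
theorem norm_ratRC_div_cosh_sq_le_tail (n : ℕ) (u : ℝ) {y₀ y : ℝ} (h0 : 0 < y₀) (hn : (27 * n : ℝ) ≤ 3 * y₀)
    (hy : y₀ ≤ |y|) :
    ‖ratRC n ((u : ℂ) + (y : ℂ) * I)‖ / Real.cosh (Real.pi * y) ^ 2 ≤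
      4 * (‖ratRC n ((u : ℂ) + (y₀ : ℂ) * I)‖ * Real.exp (-(2 * Real.pi * y₀))) *
        Real.exp (-(3 * (|y| - y₀))) := by
  have hN : ‖ratRC n ((u : ℂ) + (y : ℂ) * I)‖ ≤
      (|y| / y₀) ^ (27 * n) * ‖ratRC n ((u : ℂ) + (y₀ : ℂ) * I)‖ := by
    rw [← norm_ratRC_abs]
    exact norm_ratRC_le_pow_mul n u h0 hy
  have hK := one_div_cosh_sq_le y
  have hE := pow_mul_exp_le n h0 hy hn
  have hc : 0 < Real.cosh (Real.pi * y) ^ 2 := pow_pos (Real.cosh_pos _) 2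
  have hR0 : 0 ≤ ‖ratRC n ((u : ℂ) + (y₀ : ℂ) * I)‖ := norm_nonneg _
  calc ‖ratRC n ((u : ℂ) + (y : ℂ) * I)‖ / Real.cosh (Real.pi * y) ^ 2
        = ‖ratRC n ((u : ℂ) + (y : ℂ) * I)‖ * (1 / Real.cosh (Real.pi * y) ^ 2) := by
          rw [mul_one_div]
    _ ≤ (|y| / y₀) ^ (27 * n) * ‖ratRC n ((u : ℂ) + (y₀ : ℂ) * I)‖ * (4 * Real.exp (-(2 * Real.pi * |y|))) :=
          mul_le_mul hN hK (by positivity) (by positivity)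
    _ = 4 * ‖ratRC n ((u : ℂ) + (y₀ : ℂ) * I)‖ * ((|y| / y₀) ^ (27 * n) * Real.exp (-(2 * Real.pi * |y|))) := by
          ring
    _ ≤ 4 * ‖ratRC n ((u : ℂ) + (y₀ : ℂ) * I)‖ * (Real.exp (-(2 * Real.pi * y₀)) * Real.exp (-(3 * (|y| - y₀)))) :=
          mul_le_mul_of_nonneg_left hE (by positivity)
    _ = 4 * (‖ratRC n ((u : ℂ) + (y₀ : ℂ) * I)‖ * Real.exp (-(2 * Real.pi * y₀))) *
          Real.exp (-(3 * (|y| - y₀))) := by ring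

/-- The tree's line argument is of the form `u + iy` with `u = xₙ + ½ − (11n+1)` real. -/
theorem line_arg_eq (x n : ℕ) (y : ℝ) :
    ((((x : ℝ) + 1 / 2 : ℝ) : ℂ) - (11 * n + 1) + (y : ℂ) * I) =
      ((((x : ℝ) + 1 / 2 - (11 * n + 1) : ℝ) : ℂ) + (y : ℂ) * I) := by
  push_cast; ring

/-- **E5-3 on the tree's half-integer line, `y₀ = 9n`** (`n ≥ 1`): for `|y| ≥ 9n`,
`‖ratRC n (xₙ + ½ − a₂* + iy)‖ / cosh²(πy) ≤ 4 · (‖ratRC n (xₙ + ½ − a₂* + 9n·i)‖ · e^{−18πn}) · e^{−3(|y|−9n)}`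
— the `|y| ≥ 9n` half of the majorant `gₙ` of `P15KERNEL.md` §8.5. -/
theorem norm_ratRC_line_div_cosh_sq_le_tail {n : ℕ} (hn : 1 ≤ n) (x : ℕ) {y : ℝ} (hy : (9 * n : ℝ) ≤ |y|) :
    ‖ratRC n ((((x : ℝ) + 1 / 2 : ℝ) : ℂ) - (11 * n + 1) + (y : ℂ) * I)‖ / Real.cosh (Real.pi * y) ^ 2 ≤
      4 * (‖ratRC n ((((x : ℝ) + 1 / 2 : ℝ) : ℂ) - (11 * n + 1) + ((9 * n : ℝ) : ℂ) * I)‖ *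
        Real.exp (-(2 * Real.pi * (9 * n)))) * Real.exp (-(3 * (|y| - 9 * n))) := by
  rw [line_arg_eq, line_arg_eq]
  have h0 : (0 : ℝ) < 9 * n := by
    have : (1 : ℝ) ≤ n := by exact_mod_cast hn
    linarith
  exact norm_ratRC_div_cosh_sq_le_tail n _ h0 (by linarith) hy

end Summit.KontsevichZagierPeriods.Zeta5Search.Denom.TwoTaleP15LineTail

end
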